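import Mathlib
import Summits.Ventures.FusionMHD.Models.CerfonFreidbergIterLikeQ90Defs
import HarnessLib

/-!
# Ventures/FusionMHD — Models/CerfonFreidbergIterLikeQ90Panels9.lean: KERNEL CHECK of panels 30, 31 (of 32) of the
# certified safety factor `q(ψ_N = 9/10)/F` of THE Cerfon–Freidberg ITER-like instance (sibling of `…IterLikeQHalfPanels*.lean`)

HONEST FRAMING (LADDER-GRIDFUSION three columns; CF rung, F2 item R2, q-profile sample).  One `decide +kernel` (≈ 103 s on the farm): for
each panel `j` listed, the per-panel obligation `CFIterLike.Q90.PanelCert.ok` (`Models/CerfonFreidbergIterLikeQ90Defs.lean`) — the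
Taylor-model run of `CFIterLike.Q90.progG` over the ITER-like parameter box is ACCEPTED (every `log`/`sin`/`cos` composition and the `inv`
certificate), and the kernel's panel-integral enclosure of the polar `(6.35)` integrand along the approximant, the range of the flux residual
`U(ray m) − U_a/10`, the range of the approximant `m` and the range of the radial derivative `D_r(θ, m)` lie inside the integers claimed in
`panelCert9` (values read off a compiled `#eval` of the same functions, slack one unit of `2⁻⁶⁰`; probe `QProbeIF*.lean`, generator
`pub/gridfusion/models/gen-model-5/g8/gen90/mkdefsN.py`).  What these Booleans MEAN (real-number statements, uniformly over the parameter box ∋ THE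
ITER-like instance) is proved once in `Models/CerfonFreidbergIterLikeQ90Sound.lean`.  MODELLED: analytic Cerfon–Freidberg family; `q` of a
MODEL surface — nothing about a device or stability.  No `native_decide`.  Typer/prover: gridfusion-model-5 (g8), 2026-08-27.
Citations: Freidberg 2014 §6.3.5 (6.35) [Freidberg2014]; Mahboubi–Melquiond–Sibut-Pinote 2016 §3.2 Lemma 3 [MahboubiMelquiondSibutpinote2016].
-/

namespace Summit.Ventures.FusionMHD.Models.CFIterLike.Q90

/-- The certificate data of panels 30, 31 (`ψ_N = 9/10`): `inv` candidate (degree-12 fit of `(X·D_r)⁻¹` in the panel variable, scaled by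
`2⁶⁰`), Taylor degree, `inv` widening `2^elog2`, and the claimed integral / residual / `m`-range / `D_r`-range integers (× `2⁶⁰`). [instance data] -/
def panelCert9 : List PanelCert := [
  { j := 30, cand := [10416819497444173824, -4687540808313290752, 51353659118361903104, -28878555740233281536, 153917651467670880256, 12446998902515355648, -253275530863394553856, 2151560462867661062144, -10041357911594081714176, 19820220066756982472704, 3596364656885102861615104, 19069439922091966196613120, -5356293403255130760861974528],
    deg := 12, elog2 := 34, plo := 353677714692914397, phi := 353677716080764930, eta := 45185213, mlo := 395694612721569784, mhi := 401157974889757121,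
    dlo := 179726058795479402, dhi := 182991282363295863 },
  { j := 31, cand := [10319749578643001344, -1543727334844245504, 49549463515235573760, -9613510650758066176, 153926314786125709312, -3864968427243963904, 21527802852238536704, 547819190707850903552, -3531529582797843857408, -5465202077338949386240, -4721211637205694607785984, 18582638681122162006294528, 6966439001443437302744350720],
    deg := 14, elog2 := 35, plo := 347649556528251903, phi := 347649559113236632, eta := 55680553, mlo := 394173121961485817, mhi := 396488244726249963,
    dlo := 182527383831167294, dhi := 183936312534542651 }]

/-- **KERNEL CHECK** of panels 30, 31 of the ITER-like surface `ψ_N = 9/10`. -/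
theorem panelCert9_ok : CFIterLike.Q90.panelCert9.all PanelCert.ok = true := by
  decide +kernel

end Summit.Ventures.FusionMHD.Models.CFIterLike.Q90
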